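import Summits.QuantumAdvantage.AdviceFreeQNC0.CounterLaws
import HarnessLib

/-!
# Counter strategies VI — the `(g, a, q)`-model with a GENERAL FIBRE TYPE `Q` (step §7/§2–§3 of qn-p2 g16's R15 blueprint)

Planner qa-qnc0-p2 g16, `HOME/qa-qnc0-p2/line16/R15-blueprint.md` (rung R15 `WalkHardFLinSideInfo`: linear side information).
This file generalises the strategy-free half of `CounterLaws`/`CounterStrategies`/`CounterDoob` from the fibre `ZMod p` (one counter)
to an arbitrary finite additive group `Q` (blueprint: `Q = Fin K → ZMod p`, the prefix values of `K` linear forms), with the bit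
acting on the fibre by a translation `q ↦ q + col` (`col` = the column of the forms at the current position):
* state space `StQ Q = V₄ × ℤ/3 × Q`, shift `shQ col k : (g,a,q) ↦ (g, a+k, q + k•col)` (`k = 1`: the twist `Δ_t`);
* `massQ`, `phiQ = Σ_q min_{L ∈ 𝓛} μ(L×{q})` over the SAME translate family `mem` of `CounterLaws` (the register/label dictionary
  does not see the fibre): `abs_phiQ_sub_phiQ_le` (ℓ¹-Lipschitz), `phiQ_fire` (fibre-wise toggles), **`phiQ_mono_of_mixture`** — bit
  monotonicity for the WEIGHTED mixture (★) of the blueprint with fibre-measurable weights `r₀ + r₁ = 1` (the conditioned dynamics;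
  `r₀ = r₁ = ½` is `phi_bit_le`), `phiQ_ge_third` (label-constant laws), `phiQ_le_mass_sum`;
* the averaged law `lamQ col m μ = ⅓(μ + Δ^m μ + Δ^{2m} μ)` for `m • col = 0`: `l1_lamQ_le` (`‖μ − λ̃‖₁ ≤ m·‖μ − Δμ‖₁`),
  `lamQ_const` (`3 ∤ m` ⇒ label-constant fibres), `sum_lamQ`, so (†) of the blueprint: `Φ(μ) ≥ mass/3 − m·‖μ − Δμ‖₁` (`phiQ_ge_of_twist`).
WHAT THIS IS NOT: no process, no cell conditioning (M1/M2), no entropy budget (§4 of the blueprint) — those are the R15 prover's remaining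
work; instrument; separation NOT moved.
-/

namespace Summit.QuantumAdvantage.AdviceFreeQNC0.CounterLaw

open Finset

variable {Q : Type*}

/-- the state space `V₄ × ℤ/3 × Q`. -/
abbrev StQ (Q : Type*) := (Bool × Bool) × ZMod 3 × Q

/-- the simultaneous shift of label and fibre: `(g, a, q) ↦ (g, a + k, q + k • col)`. -/
def shQ [AddCommGroup Q] (col : Q) (k : ℕ) : StQ Q ≃ StQ Q where
  toFun x := (x.1, x.2.1 + k, x.2.2 + k • col)
  invFun x := (x.1, x.2.1 - k, x.2.2 - k • col)
  left_inv x := by simp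
  right_inv x := by simp

/-- the inverse shift. -/
theorem shQ_symm_apply [AddCommGroup Q] (col : Q) (k : ℕ) (x : StQ Q) : (shQ col k).symm x = (x.1, x.2.1 - k, x.2.2 - k • col) := rfl

/-- `shQ col k = (shQ col 1)^k`. -/
theorem shQ_eq_pow [AddCommGroup Q] (col : Q) (k : ℕ) : shQ col k = (shQ col 1) ^ k := by
  induction k with
  | zero => ext x <;> simp [shQ]
  | succ k ih =>
    rw [pow_succ, ← ih]
    ext x <;> simp [shQ, Equiv.Perm.mul_def, add_smul] <;> abel

/-! ## §1 Masses and the functional -/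

/-- mass of `L_i × {q}`. -/
def massQ (μ : StQ Q → ℝ) (i : Idx) (q : Q) : ℝ :=
  ∑ g : Bool × Bool, ∑ a : ZMod 3, if mem i g a then μ (g, a, q) else 0

/-- fibre mass. -/
def fibQ (μ : StQ Q → ℝ) (q : Q) : ℝ := ∑ g : Bool × Bool, ∑ a : ZMod 3, μ (g, a, q)

/-- `Φ(μ) = Σ_q min_{L ∈ 𝓛} μ(L × {q})`. -/
noncomputable def phiQ [Fintype Q] (μ : StQ Q → ℝ) : ℝ :=
  ∑ q : Q, (univ : Finset Idx).inf' ⟨(0, none), mem_univ _⟩ fun i => massQ μ i q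

/-- a sum over the state space, fibred. -/
theorem sum_StQ [Fintype Q] (f : StQ Q → ℝ) : ∑ x, f x = ∑ q : Q, ∑ g : Bool × Bool, ∑ a : ZMod 3, f (g, a, q) := by
  rw [Fintype.sum_prod_type]
  have h : ∀ g : Bool × Bool, ∑ aq : ZMod 3 × Q, f (g, aq) = ∑ q : Q, ∑ a : ZMod 3, f (g, a, q) := by
    intro g; rw [Fintype.sum_prod_type, Finset.sum_comm]
  simp only [h]
  rw [Finset.sum_comm]

/-- masses of two laws differ by at most the fibre's `ℓ¹` distance. -/
theorem abs_massQ_sub_massQ_le (μ ν : StQ Q → ℝ) (i : Idx) (q : Q) :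
    |massQ μ i q - massQ ν i q| ≤ ∑ g : Bool × Bool, ∑ a : ZMod 3, |μ (g, a, q) - ν (g, a, q)| := by
  unfold massQ
  rw [← sum_sub_distrib]
  refine (abs_sum_le_sum_abs _ _).trans (sum_le_sum fun g _ => ?_)
  rw [← sum_sub_distrib]
  refine (abs_sum_le_sum_abs _ _).trans (sum_le_sum fun a _ => ?_)
  split_ifs <;> simp

/-- **`Φ` is `ℓ¹`-Lipschitz.** -/
theorem abs_phiQ_sub_phiQ_le [Fintype Q] (μ ν : StQ Q → ℝ) : |phiQ μ - phiQ ν| ≤ l1 μ ν := by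
  unfold phiQ l1
  rw [← sum_sub_distrib, sum_StQ]
  refine (abs_sum_le_sum_abs _ _).trans (sum_le_sum fun q _ => ?_)
  exact inf'_sub_inf'_le _ _ _ _ _ fun i _ => abs_massQ_sub_massQ_le μ ν i q

/-- fire invariance of masses (fibrewise toggle permutes `𝓛`). -/
theorem massQ_fire (μ : StQ Q → ℝ) (i : Idx) (q : Q) :
    massQ (fun x => μ (tog x.2.1 x.1, x.2.1, x.2.2)) i q = massQ μ (togIdx i) q := by
  unfold massQ
  rw [Finset.sum_comm, Finset.sum_comm (f := fun g a => if mem (togIdx i) g a = true then μ (g, a, q) else 0)]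
  refine sum_congr rfl fun a _ => ?_
  rw [← Equiv.sum_comp (Function.Involutive.toPerm (tog a) (tog_tog a))
    (fun g => if mem (togIdx i) g a = true then μ (g, a, q) else 0)]
  refine sum_congr rfl fun g _ => ?_
  simp only [Function.Involutive.coe_toPerm, mem_togIdx, tog_tog]

/-- **`Φ` is invariant under a fibre-wise fire.** -/
theorem phiQ_fire [Fintype Q] (μ : StQ Q → ℝ) (F : Q → Bool) :
    phiQ (fun x => μ (if F x.2.2 then tog x.2.1 x.1 else x.1, x.2.1, x.2.2)) = phiQ μ := by
  unfold phiQ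
  refine sum_congr rfl fun q _ => ?_
  cases hq : F q
  · simp only [massQ, hq, if_false, Bool.false_eq_true]
  · have hm : ∀ i, massQ (fun x : StQ Q => μ (if F x.2.2 then tog x.2.1 x.1 else x.1, x.2.1, x.2.2)) i q
        = massQ μ (togEquiv i) q := by
      intro i
      show _ = massQ μ (togIdx i) q
      rw [← massQ_fire]
      simp only [massQ, hq, if_true]
    simp only [hm]
    exact inf'_comp_equiv _ togEquiv (fun i => massQ μ i q)

/-- mass after relabelling `a ↦ a + k` inside a fibre. -/
theorem massQ_shift (μ : StQ Q → ℝ) (k : ZMod 3) (i : Idx) (q : Q) :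
    (∑ g : Bool × Bool, ∑ a : ZMod 3, if mem i g a then μ (g, a - k, q) else 0) = massQ μ (shIdx k i) q := by
  unfold massQ
  refine sum_congr rfl fun g _ => ?_
  rw [← Equiv.sum_comp (Equiv.subRight k) (fun a => if mem (shIdx k i) g a = true then μ (g, a, q) else 0)]
  refine sum_congr rfl fun a _ => ?_
  simp only [Equiv.subRight_apply, mem_shIdx, sub_add_cancel]

/-- **BIT MONOTONICITY for a fibre-measurable mixture** (blueprint §2(d), (★)): if for every translate `L` and target fibre `q'`
`μ'(L×{q'}) ≥ r₀(q')·μ(τ₁⁻¹L × {q'}) + r₁(q' − col)·μ(τ₂⁻¹L × {q' − col})` with weights `r₀, r₁ ≥ 0`, `r₀ + r₁ = 1` depending on the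
SOURCE fibre, then `Φ(μ) ≤ Φ(μ')`.  (`r₀ = r₁ = ½` is the free-bit step `phi_bit_le`.) -/
theorem phiQ_mono_of_mixture [AddCommGroup Q] [Fintype Q] (μ μ' : StQ Q → ℝ) (col : Q) (r₀ r₁ : Q → ℝ) (h0 : ∀ q, 0 ≤ r₀ q) (h1 : ∀ q, 0 ≤ r₁ q)
    (hsum : ∀ q, r₀ q + r₁ q = 1)
    (hmix : ∀ (i : Idx) (q' : Q),
      r₀ q' * massQ μ (shIdx 1 i) q' + r₁ (q' - col) * massQ μ (shIdx 2 i) (q' - col) ≤ massQ μ' i q') :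
    phiQ μ ≤ phiQ μ' := by
  unfold phiQ
  set m : Q → ℝ := fun q => univ.inf' ⟨(0, none), mem_univ _⟩ fun i => massQ μ i q with hm
  have hlow : ∀ q', r₀ q' * m q' + r₁ (q' - col) * m (q' - col)
      ≤ univ.inf' ⟨(0, none), mem_univ _⟩ (fun i => massQ μ' i q') := by
    intro q'
    refine le_inf' _ _ fun i _ => ?_
    have ha : m q' ≤ massQ μ (shIdx 1 i) q' := inf'_le _ (mem_univ _)
    have hb : m (q' - col) ≤ massQ μ (shIdx 2 i) (q' - col) := inf'_le _ (mem_univ _)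
    have := hmix i q'
    nlinarith [h0 q', h1 (q' - col)]
  have hs : ∑ q' : Q, r₁ (q' - col) * m (q' - col) = ∑ q : Q, r₁ q * m q :=
    Equiv.sum_comp (Equiv.subRight col) (fun q => r₁ q * m q)
  calc ∑ q, m q = ∑ q, (r₀ q * m q + r₁ q * m q) := sum_congr rfl fun q _ => by rw [← add_mul, hsum, one_mul]
    _ = ∑ q', (r₀ q' * m q' + r₁ (q' - col) * m (q' - col)) := by rw [sum_add_distrib, sum_add_distrib, hs]
    _ ≤ _ := sum_le_sum fun q' _ => hlow q'

/-- the free-bit step as a mixture: `μ'(g,a,q) = ½(μ(g,a−1,q) + μ(g,a−2,q−col))` ⇒ `Φ(μ) ≤ Φ(μ')`. -/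
theorem phiQ_bit_le [AddCommGroup Q] [Fintype Q] (μ : StQ Q → ℝ) (col : Q) :
    phiQ μ ≤ phiQ (fun x => (μ (x.1, x.2.1 - 1, x.2.2) + μ (x.1, x.2.1 - 2, x.2.2 - col)) / 2) := by
  refine phiQ_mono_of_mixture μ _ col (fun _ => 1 / 2) (fun _ => 1 / 2) (fun _ => by norm_num) (fun _ => by norm_num)
    (fun _ => by norm_num) fun i q' => le_of_eq ?_
  rw [← massQ_shift μ 1 i q', ← massQ_shift μ 2 i (q' - col)]
  unfold massQ
  rw [mul_sum, mul_sum, ← sum_add_distrib]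
  refine sum_congr rfl fun g _ => ?_
  rw [mul_sum, mul_sum, ← sum_add_distrib]
  refine sum_congr rfl fun a _ => ?_
  split_ifs <;> ring

/-- **two-block bound**: nonnegative label-constant laws have `Φ(μ) ≥ (Σ μ)/3`. -/
theorem phiQ_ge_third [Fintype Q] (μ : StQ Q → ℝ) (hμ : ∀ x, 0 ≤ μ x) (hconst : ∀ g a q, μ (g, a, q) = μ (g, 0, q)) :
    (∑ x, μ x) / 3 ≤ phiQ μ := by
  unfold phiQ
  rw [sum_StQ, sum_div]
  refine sum_le_sum fun q _ => le_inf' _ _ fun i _ => ?_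
  unfold massQ
  rw [sum_div]
  refine sum_le_sum fun g _ => ?_
  obtain ⟨a₀, ha₀⟩ := exists_mem_idx i g
  have hsum : ∑ a : ZMod 3, μ (g, a, q) = 3 * μ (g, 0, q) := by
    rw [sum_congr rfl fun a _ => hconst g a q, sum_const, card_univ, ZMod.card, nsmul_eq_mul, Nat.cast_ofNat]
  calc (∑ a : ZMod 3, μ (g, a, q)) / 3 = μ (g, a₀, q) := by rw [hsum, hconst g a₀ q]; ring
    _ = (if mem i g a₀ = true then μ (g, a₀, q) else 0) := by rw [if_pos ha₀]
    _ ≤ ∑ a : ZMod 3, if mem i g a = true then μ (g, a, q) else 0 :=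
        single_le_sum (f := fun a => if mem i g a = true then μ (g, a, q) else 0)
          (fun a _ => by split_ifs <;> simp [hμ]) (mem_univ a₀)

/-- the LOSE mass dominates `Φ`. -/
theorem phiQ_le_mass_sum [Fintype Q] (μ : StQ Q → ℝ) (i₀ : Idx) : phiQ μ ≤ ∑ q : Q, massQ μ i₀ q :=
  sum_le_sum fun _ _ => inf'_le _ (mem_univ i₀)

/-! ## §2 The twist and the averaged law (blueprint §3) -/

/-- `λ̃ = ⅓(μ + Δ^m μ + Δ^{2m} μ)` for the twist `Δ = shQ col 1`. -/
noncomputable def lamQ [AddCommGroup Q] (col : Q) (m : ℕ) (μ : StQ Q → ℝ) (x : StQ Q) : ℝ :=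
  (μ x + μ ((shQ col m).symm x) + μ ((shQ col (2 * m)).symm x)) / 3

/-- same total mass. -/
theorem sum_lamQ [AddCommGroup Q] [Fintype Q] (col : Q) (m : ℕ) (μ : StQ Q → ℝ) : ∑ x, lamQ col m μ x = ∑ x, μ x := by
  unfold lamQ
  rw [← sum_div, sum_add_distrib, sum_add_distrib, Equiv.sum_comp (shQ col m).symm μ,
    Equiv.sum_comp (shQ col (2 * m)).symm μ]
  ring

/-- nonnegativity. -/
theorem lamQ_nonneg [AddCommGroup Q] (col : Q) (m : ℕ) (μ : StQ Q → ℝ) (hμ : ∀ x, 0 ≤ μ x) (x : StQ Q) : 0 ≤ lamQ col m μ x := by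
  unfold lamQ
  exact div_nonneg (add_nonneg (add_nonneg (hμ _) (hμ _)) (hμ _)) (by norm_num)

/-- **(3a)** `‖μ − λ̃‖₁ ≤ m·‖μ − Δμ‖₁`. -/
theorem l1_lamQ_le [AddCommGroup Q] [Fintype Q] (col : Q) (m : ℕ) (μ : StQ Q → ℝ) :
    l1 μ (lamQ col m μ) ≤ m * l1 μ (fun x => μ ((shQ col 1).symm x)) := by
  have hk : ∀ k : ℕ, l1 μ (fun x => μ ((shQ col k).symm x)) ≤ k * l1 μ (fun x => μ ((shQ col 1).symm x)) := by
    intro k; rw [shQ_eq_pow]; exact l1_iterate_le (shQ col 1) μ k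
  have h1 := hk m
  have h2 := hk (2 * m)
  have hsum : l1 μ (lamQ col m μ)
      ≤ (l1 μ (fun x => μ ((shQ col m).symm x)) + l1 μ (fun x => μ ((shQ col (2 * m)).symm x))) / 3 := by
    unfold l1
    rw [← sum_add_distrib, sum_div]
    refine sum_le_sum fun x _ => ?_
    dsimp only
    unfold lamQ
    rw [le_div_iff₀ (by norm_num : (0 : ℝ) < 3)]
    have : |μ x - (μ x + μ ((shQ col m).symm x) + μ ((shQ col (2 * m)).symm x)) / 3| * 3
        = |(μ x - μ ((shQ col m).symm x)) + (μ x - μ ((shQ col (2 * m)).symm x))| := by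
      rw [← abs_of_pos (by norm_num : (0 : ℝ) < 3), ← abs_mul]; congr 1; ring
    rw [this]; exact abs_add_le _ _
  push_cast at h2
  have hl := l1_nonneg μ (fun x => μ ((shQ col 1).symm x))
  nlinarith

/-- `λ̃` is invariant under the label rotation by `m` when `m • col = 0` (then `Δ^m` is a pure label rotation and `Δ^{3m} = 1`). -/
theorem lamQ_shift [AddCommGroup Q] (col : Q) (m : ℕ) (hm : m • col = 0) (μ : StQ Q → ℝ) (g : Bool × Bool) (a : ZMod 3) (q : Q) :
    lamQ col m μ (g, a - (m : ZMod 3), q) = lamQ col m μ (g, a, q) := by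
  unfold lamQ
  simp only [shQ_symm_apply]
  have h3 : ((3 * m : ℕ) : ZMod 3) = 0 := by rw [ZMod.natCast_eq_zero_iff]; exact dvd_mul_right 3 m
  have e1 : a - (m : ZMod 3) - ((2 * m : ℕ) : ZMod 3) = a := by
    rw [sub_sub, ← Nat.cast_add, show m + 2 * m = 3 * m by ring, h3, sub_zero]
  have e2 : q - (2 * m) • col = q := by rw [mul_smul, hm, smul_zero, sub_zero]
  have e3 : q - m • col = q := by rw [hm, sub_zero]
  have e4 : a - ((2 * m : ℕ) : ZMod 3) = a - (m : ZMod 3) - (m : ZMod 3) := by push_cast; ring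
  simp only [e1, e2, e3, e4]
  ring

/-- **(3b)** for `3 ∤ m` and `m • col = 0` the fibres of `λ̃` are constant in the label. -/
theorem lamQ_const [AddCommGroup Q] (col : Q) (m : ℕ) (hm : m • col = 0) (h3 : ¬ 3 ∣ m) (μ : StQ Q → ℝ) (g : Bool × Bool) (a : ZMod 3)
    (q : Q) : lamQ col m μ (g, a, q) = lamQ col m μ (g, 0, q) := by
  have hp : (m : ZMod 3) ≠ 0 := by rwa [Ne, ZMod.natCast_eq_zero_iff]
  have hs : ∀ a', lamQ col m μ (g, a' - (m : ZMod 3), q) = lamQ col m μ (g, a', q) := fun a' => lamQ_shift col m hm μ g a' q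
  have hcases : ∀ d : ZMod 3, d ≠ 0 → ∀ a' : ZMod 3, a' = 0 ∨ a' = 0 - d ∨ a' = 0 - d - d := by decide
  rcases hcases _ hp a with h | h | h
  · rw [h]
  · rw [h, hs]
  · rw [h, hs, hs]

/-- the fibres of `λ̃` are those of `μ` (when `m • col = 0`). -/
theorem fibQ_lamQ [AddCommGroup Q] (col : Q) (m : ℕ) (hm : m • col = 0) (μ : StQ Q → ℝ) (q : Q) : fibQ (lamQ col m μ) q = fibQ μ q := by
  unfold fibQ lamQ
  simp only [shQ_symm_apply]
  have e2 : q - (2 * m) • col = q := by rw [mul_smul, hm, smul_zero, sub_zero]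
  have e3 : q - m • col = q := by rw [hm, sub_zero]
  simp only [e2, e3]
  have hr : ∀ (k : ZMod 3) (g : Bool × Bool), ∑ a : ZMod 3, μ (g, a - k, q) = ∑ a : ZMod 3, μ (g, a, q) := by
    intro k g
    exact Equiv.sum_comp (Equiv.subRight k) (fun a => μ (g, a, q))
  refine sum_congr rfl fun g _ => ?_
  rw [← sum_div, sum_add_distrib, sum_add_distrib, hr, hr]; ring

/-- **(†) of the blueprint**: for a nonnegative law `μ`, a column `col` with `m • col = 0`, `3 ∤ m`:
`Φ(μ) ≥ (Σ μ)/3 − m·‖μ − Δμ‖₁`. -/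
theorem phiQ_ge_of_twist [AddCommGroup Q] [Fintype Q] (col : Q) (m : ℕ) (hm : m • col = 0) (h3 : ¬ 3 ∣ m) (μ : StQ Q → ℝ) (hμ : ∀ x, 0 ≤ μ x) :
    (∑ x, μ x) / 3 - m * l1 μ (fun x => μ ((shQ col 1).symm x)) ≤ phiQ μ := by
  have hthird : (∑ x, μ x) / 3 ≤ phiQ (lamQ col m μ) := by
    rw [← sum_lamQ col m μ]
    exact phiQ_ge_third _ (lamQ_nonneg col m μ hμ) (fun g a q => lamQ_const col m hm h3 μ g a q)
  have hlip := abs_phiQ_sub_phiQ_le μ (lamQ col m μ)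
  have hl := l1_lamQ_le col m μ
  rw [abs_le] at hlip
  linarith [hlip.1]

end Summit.QuantumAdvantage.AdviceFreeQNC0.CounterLaw
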